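import Mathlib
import Summits.Ventures.PercRepro2.K5K3Multi
import Summits.Ventures.PercRepro2.K5TypedI

/-!
# THE TYPED (ii) AND (i) BASES ON EVERY ALL-MARKED MULTIGRAPH WITH FIVE DISTINCT MARKS
(blind cell PercRepro2, typer-1 g10; mine-1 §23.1's multigraph base terms `N(H + e(1))`, `N(H + e(2))`,
`N(H + e(1) + e′(1))` of the (ii) / (i) lines as kernel theorems)

p1's state kernels `KII` / `KI` only read connections (`KII_congr_conn`, `KI_congr_conn`), so they are invariant
under merging a parallel edge or closing a loop; the typed parallel rule `typedCount_merge` and the loop rule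
`typedCount_loop` (`K5K3Merge.lean`, `K5K3Multi.lean`) reduce a typed count on an all-marked multigraph to
typed counts on simple graphs, which are typed counts on `K₅` along the pattern map of the vertex map
(`KII_patternM`, `typedCount_patternM_eq`), nonnegative by `K5Typed.typedCount_KII_nonneg` /
`K5TypedI.typedCount_KI_nonneg`:

* **`typedCount_KII_nonneg_multi`**, **`typedCount_KI_nonneg_multi`**: for five DISTINCT marks, every typed
  count `typedCount F (fun _ => false) τ (KII ends o a₁ a₂ a₃ b)` (resp. `KI`) on a set `F` of typed edges
  whose ends are all marks — loops and parallel edges allowed, every type map — is `≥ 0`.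
-/

namespace Summit.Ventures.PercRepro2

open Hub

namespace K5

/-! ## The state kernels only read connections -/

section Kernels

variable {V : Type*} {E : Type*} {R : Type*} [Field R] (ends : E → Sym2 V)

/-- **`KII` only reads connections.** -/
theorem KII_congr_conn (o a₁ a₂ a₃ b : V) {x x' y y' w w' : Config E}
    (hx : ∀ u v, Conn ends x u v ↔ Conn ends x' u v) (hy : ∀ u v, Conn ends y u v ↔ Conn ends y' u v)
    (hw : ∀ u v, Conn ends w u v ↔ Conn ends w' u v) :
    CaseOne.KII (R := R) ends o a₁ a₂ a₃ b x y w = CaseOne.KII (R := R) ends o a₁ a₂ a₃ b x' y' w' := by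
  classical
  unfold CaseOne.KII CovForm.sepKernel CaseOne.iQ CaseOne.iA CaseOne.iQB CaseOne.iAB CaseOne.iAO
    CaseOne.iABO CaseOne.iPDc CaseOne.iPDoU
  simp only [Fin.sum_univ_succ, Fin.sum_univ_zero, Matrix.cons_val_zero, Matrix.cons_val_succ, add_zero,
    Set.indicator_apply, Set.mem_inter_iff, Set.mem_compl_iff, Set.mem_union, mem_connEvent, Pi.one_apply,
    hx, hy, hw]

/-- **`KI` only reads connections.** -/
theorem KI_congr_conn (o a₁ a₂ a₃ b : V) {x x' y y' w w' : Config E}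
    (hx : ∀ u v, Conn ends x u v ↔ Conn ends x' u v) (hy : ∀ u v, Conn ends y u v ↔ Conn ends y' u v)
    (hw : ∀ u v, Conn ends w u v ↔ Conn ends w' u v) :
    CaseOne.KI (R := R) ends o a₁ a₂ a₃ b x y w = CaseOne.KI (R := R) ends o a₁ a₂ a₃ b x' y' w' := by
  classical
  unfold CaseOne.KI CovForm.sepKernel CaseOne.iQ CaseOne.iA CaseOne.iQB₁ CaseOne.iAB₁ CaseOne.iAO
    CaseOne.iAB₁O CaseOne.iPDc CaseOne.iPDoU
  simp only [Fin.sum_univ_succ, Fin.sum_univ_zero, Matrix.cons_val_zero, Matrix.cons_val_succ, add_zero,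
    Set.indicator_apply, Set.mem_inter_iff, Set.mem_compl_iff, Set.mem_union, mem_connEvent, Pi.one_apply,
    hx, hy, hw]

variable [DecidableEq E]

/-- `KII` is invariant under the merge of a parallel pair. -/
theorem KII_mergeT (o a₁ a₂ a₃ b : V) {e e' : E} (hpar : ends e = ends e') (hne : e ≠ e') (T : Tri E) :
    CaseOne.KII (R := R) ends o a₁ a₂ a₃ b T.1 T.2.1 T.2.2 =
      CaseOne.KII (R := R) ends o a₁ a₂ a₃ b (mergeT e e' T).1 (mergeT e e' T).2.1 (mergeT e e' T).2.2 := by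
  rw [mergeT_fst, mergeT_snd, mergeT_thd]
  exact KII_congr_conn ends o a₁ a₂ a₃ b (fun u v => (conn_mergeC ends hpar hne _ u v).symm)
    (fun u v => (conn_mergeC ends hpar hne _ u v).symm) (fun u v => (conn_mergeC ends hpar hne _ u v).symm)

/-- `KI` is invariant under the merge of a parallel pair. -/
theorem KI_mergeT (o a₁ a₂ a₃ b : V) {e e' : E} (hpar : ends e = ends e') (hne : e ≠ e') (T : Tri E) :
    CaseOne.KI (R := R) ends o a₁ a₂ a₃ b T.1 T.2.1 T.2.2 =
      CaseOne.KI (R := R) ends o a₁ a₂ a₃ b (mergeT e e' T).1 (mergeT e e' T).2.1 (mergeT e e' T).2.2 := by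
  rw [mergeT_fst, mergeT_snd, mergeT_thd]
  exact KI_congr_conn ends o a₁ a₂ a₃ b (fun u v => (conn_mergeC ends hpar hne _ u v).symm)
    (fun u v => (conn_mergeC ends hpar hne _ u v).symm) (fun u v => (conn_mergeC ends hpar hne _ u v).symm)

/-- `KII` is invariant under closing a loop. -/
theorem KII_closeT (o a₁ a₂ a₃ b : V) {e : E} (hloop : (ends e).IsDiag) (T : Tri E) :
    CaseOne.KII (R := R) ends o a₁ a₂ a₃ b T.1 T.2.1 T.2.2 =
      CaseOne.KII (R := R) ends o a₁ a₂ a₃ b (closeT e T).1 (closeT e T).2.1 (closeT e T).2.2 :=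
  KII_congr_conn ends o a₁ a₂ a₃ b (fun u v => (conn_closeLoop ends hloop _ u v).symm)
    (fun u v => (conn_closeLoop ends hloop _ u v).symm) (fun u v => (conn_closeLoop ends hloop _ u v).symm)

/-- `KI` is invariant under closing a loop. -/
theorem KI_closeT (o a₁ a₂ a₃ b : V) {e : E} (hloop : (ends e).IsDiag) (T : Tri E) :
    CaseOne.KI (R := R) ends o a₁ a₂ a₃ b T.1 T.2.1 T.2.2 =
      CaseOne.KI (R := R) ends o a₁ a₂ a₃ b (closeT e T).1 (closeT e T).2.1 (closeT e T).2.2 :=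
  KI_congr_conn ends o a₁ a₂ a₃ b (fun u v => (conn_closeLoop ends hloop _ u v).symm)
    (fun u v => (conn_closeLoop ends hloop _ u v).symm) (fun u v => (conn_closeLoop ends hloop _ u v).symm)

end Kernels

/-! ## Along the pattern map of a vertex map -/

section Pattern

variable {V : Type*} {E : Type*} [Fintype E] [DecidableEq E] [DecidableEq V]
variable (m : V → Fin 5) (ends : E → Sym2 V) (F : Finset E) {M : Set V}
variable {R : Type*} [Field R]

omit [Fintype E] [DecidableEq V] in
/-- **`KII` of `G` is `KII` of `K₅` along the pattern map**, on triples closed off `F`. -/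
theorem KII_patternM (hinj : Set.InjOn m M) (hM : ∀ e ∈ F, ∀ v ∈ ends e, v ∈ M)
    (hloop : ∀ e ∈ F, ¬ (ends e).IsDiag) {o a₁ a₂ a₃ b : V} (ho : o ∈ M) (h1 : a₁ ∈ M) (h2 : a₂ ∈ M)
    (h3 : a₃ ∈ M) (hb : b ∈ M) {x y w : Config E} (hx : ClosedOff F x) (hy : ClosedOff F y)
    (hw : ClosedOff F w) :
    CaseOne.KII (R := R) ends o a₁ a₂ a₃ b x y w =
      CaseOne.KII (R := R) ends5 (m o) (m a₁) (m a₂) (m a₃) (m b)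
        (patternM m ends F x) (patternM m ends F y) (patternM m ends F w) := by
  classical
  unfold CaseOne.KII CovForm.sepKernel CaseOne.iQ CaseOne.iA CaseOne.iQB CaseOne.iAB CaseOne.iAO
    CaseOne.iABO CaseOne.iPDc CaseOne.iPDoU
  simp only [Fin.sum_univ_succ, Fin.sum_univ_zero, Matrix.cons_val_zero, Matrix.cons_val_succ, add_zero,
    Set.indicator_apply, Set.mem_inter_iff, Set.mem_compl_iff, Set.mem_union, mem_connEvent, Pi.one_apply,
    conn_iff_patternM m ends F hinj hM hloop hx, conn_iff_patternM m ends F hinj hM hloop hy,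
    conn_iff_patternM m ends F hinj hM hloop hw, ho, h1, h2, h3, hb]

omit [Fintype E] [DecidableEq V] in
/-- **`KI` of `G` is `KI` of `K₅` along the pattern map**, on triples closed off `F`. -/
theorem KI_patternM (hinj : Set.InjOn m M) (hM : ∀ e ∈ F, ∀ v ∈ ends e, v ∈ M)
    (hloop : ∀ e ∈ F, ¬ (ends e).IsDiag) {o a₁ a₂ a₃ b : V} (ho : o ∈ M) (h1 : a₁ ∈ M) (h2 : a₂ ∈ M)
    (h3 : a₃ ∈ M) (hb : b ∈ M) {x y w : Config E} (hx : ClosedOff F x) (hy : ClosedOff F y)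
    (hw : ClosedOff F w) :
    CaseOne.KI (R := R) ends o a₁ a₂ a₃ b x y w =
      CaseOne.KI (R := R) ends5 (m o) (m a₁) (m a₂) (m a₃) (m b)
        (patternM m ends F x) (patternM m ends F y) (patternM m ends F w) := by
  classical
  unfold CaseOne.KI CovForm.sepKernel CaseOne.iQ CaseOne.iA CaseOne.iQB₁ CaseOne.iAB₁ CaseOne.iAO
    CaseOne.iAB₁O CaseOne.iPDc CaseOne.iPDoU
  simp only [Fin.sum_univ_succ, Fin.sum_univ_zero, Matrix.cons_val_zero, Matrix.cons_val_succ, add_zero,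
    Set.indicator_apply, Set.mem_inter_iff, Set.mem_compl_iff, Set.mem_union, mem_connEvent, Pi.one_apply,
    conn_iff_patternM m ends F hinj hM hloop hx, conn_iff_patternM m ends F hinj hM hloop hy,
    conn_iff_patternM m ends F hinj hM hloop hw, ho, h1, h2, h3, hb]

end Pattern

/-! ## The theorems -/

section Theorems

variable {V : Type*} {E : Type*} [Fintype E] [DecidableEq E] [DecidableEq V]
variable {R : Type*} [Field R] [LinearOrder R] [IsStrictOrderedRing R]

/-- Five distinct marks: the mark map is injective on them and sends them to `(0, 1, 2, 3, 4)`. -/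
lemma distinct_marks {o a₁ a₂ a₃ b : V} (hb1 : b ≠ a₁) (hb2 : b ≠ a₂) (hbo : b ≠ o) (hb3 : b ≠ a₃) :
    markMap o a₁ a₂ a₃ b b = 4 := by
  simp [markMap, hbo, hb1, hb2, hb3]

/-- **The typed (ii) base on every all-marked multigraph with five distinct marks** (loops and parallel
edges allowed, every type map): `0 ≤ typedCount F (fun _ => false) τ (KII ends o a₁ a₂ a₃ b)`. -/
theorem typedCount_KII_nonneg_multi (ends : E → Sym2 V) {o a₁ a₂ a₃ b : V} (h12 : a₁ ≠ a₂)
    (h31 : a₃ ≠ a₁) (h32 : a₃ ≠ a₂) (ho1 : o ≠ a₁) (ho2 : o ≠ a₂) (hb1 : b ≠ a₁) (hb2 : b ≠ a₂) (ho3 : o ≠ a₃)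
    (hbo : b ≠ o) (hb3 : b ≠ a₃) (F : Finset E) (τ : E → ℕ)
    (hall : ∀ e ∈ F, ∀ v ∈ ends e, v = o ∨ v = a₁ ∨ v = a₂ ∨ v = a₃ ∨ v = b) :
    0 ≤ typedCount F (fun _ => false) τ (CaseOne.KII (R := R) ends o a₁ a₂ a₃ b) := by
  induction hn : F.card using Nat.strong_induction_on generalizing F τ with
  | _ n ih =>
  by_cases hl : ∃ e ∈ F, (ends e).IsDiag
  · obtain ⟨e, he, hloop⟩ := hl
    rw [typedCount_loop F τ _ he (KII_closeT ends o a₁ a₂ a₃ b hloop)]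
    refine mul_nonneg (Nat.cast_nonneg _) ?_
    refine ih (F.erase e).card ?_ (F.erase e) τ ?_ rfl
    · rw [← hn]; exact Finset.card_erase_lt_of_mem he
    · exact fun g hg => hall g (Finset.mem_of_mem_erase hg)
  by_cases hpar : ∃ e ∈ F, ∃ e' ∈ F, e ≠ e' ∧ ends e = ends e'
  · obtain ⟨e, he, e', he', hne, hpar⟩ := hpar
    rw [typedCount_merge F τ _ he he' hne (KII_mergeT ends o a₁ a₂ a₃ b hpar hne)]
    refine Finset.sum_nonneg fun t _ => mul_nonneg (Nat.cast_nonneg _) ?_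
    refine ih (F.erase e').card ?_ (F.erase e') (Function.update τ e t) ?_ rfl
    · rw [← hn]; exact Finset.card_erase_lt_of_mem he'
    · exact fun g hg => hall g (Finset.mem_of_mem_erase hg)
  -- the simple case: transfer to `K₅`
  have hloop : ∀ e ∈ F, ¬ (ends e).IsDiag := fun e he h => hl ⟨e, he, h⟩
  have hpar' : ∀ e ∈ F, ∀ e' ∈ F, ends e = ends e' → e = e' := fun e he e' he' h => by
    by_contra hne
    exact hpar ⟨e, he, e', he', hne, h⟩
  have hM : ∀ e ∈ F, ∀ v ∈ ends e, v ∈ marks o a₁ a₂ a₃ b := by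
    intro e he v hv
    simp only [marks, Set.mem_insert_iff, Set.mem_singleton_iff]
    exact hall e he v hv
  have hinj := markMap_injOn h12 h31 h32 ho1 ho2 hb1 hb2 ho3
  have ho : o ∈ marks o a₁ a₂ a₃ b := by simp [marks]
  have h1 : a₁ ∈ marks o a₁ a₂ a₃ b := by simp [marks]
  have h2 : a₂ ∈ marks o a₁ a₂ a₃ b := by simp [marks]
  have h3 : a₃ ∈ marks o a₁ a₂ a₃ b := by simp [marks]
  have hb : b ∈ marks o a₁ a₂ a₃ b := by simp [marks]
  rw [typedCount_congr_closedOff F τ _ (fun x y w =>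
      CaseOne.KII (R := R) ends5 (markMap o a₁ a₂ a₃ b o) (markMap o a₁ a₂ a₃ b a₁) (markMap o a₁ a₂ a₃ b a₂)
        (markMap o a₁ a₂ a₃ b a₃) (markMap o a₁ a₂ a₃ b b)
        (patternM (markMap o a₁ a₂ a₃ b) ends F x) (patternM (markMap o a₁ a₂ a₃ b) ends F y)
        (patternM (markMap o a₁ a₂ a₃ b) ends F w))
      (fun x y w hx hy hw => KII_patternM (markMap o a₁ a₂ a₃ b) ends F hinj hM hloop ho h1 h2 h3 hb hx hy hw),
    typedCount_patternM_eq (markMap o a₁ a₂ a₃ b) ends F hinj hM hloop hpar',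
    markMap_o, markMap_a₁ ho1, markMap_a₂ h12 ho2, markMap_a₃ h31 h32 ho3,
    distinct_marks hb1 hb2 hbo hb3]
  exact typedCount_KII_nonneg _ _ _

/-- **The typed (i) base on every all-marked multigraph with five distinct marks.** -/
theorem typedCount_KI_nonneg_multi (ends : E → Sym2 V) {o a₁ a₂ a₃ b : V} (h12 : a₁ ≠ a₂)
    (h31 : a₃ ≠ a₁) (h32 : a₃ ≠ a₂) (ho1 : o ≠ a₁) (ho2 : o ≠ a₂) (hb1 : b ≠ a₁) (hb2 : b ≠ a₂) (ho3 : o ≠ a₃)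
    (hbo : b ≠ o) (hb3 : b ≠ a₃) (F : Finset E) (τ : E → ℕ)
    (hall : ∀ e ∈ F, ∀ v ∈ ends e, v = o ∨ v = a₁ ∨ v = a₂ ∨ v = a₃ ∨ v = b) :
    0 ≤ typedCount F (fun _ => false) τ (CaseOne.KI (R := R) ends o a₁ a₂ a₃ b) := by
  induction hn : F.card using Nat.strong_induction_on generalizing F τ with
  | _ n ih =>
  by_cases hl : ∃ e ∈ F, (ends e).IsDiag
  · obtain ⟨e, he, hloop⟩ := hl
    rw [typedCount_loop F τ _ he (KI_closeT ends o a₁ a₂ a₃ b hloop)]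
    refine mul_nonneg (Nat.cast_nonneg _) ?_
    refine ih (F.erase e).card ?_ (F.erase e) τ ?_ rfl
    · rw [← hn]; exact Finset.card_erase_lt_of_mem he
    · exact fun g hg => hall g (Finset.mem_of_mem_erase hg)
  by_cases hpar : ∃ e ∈ F, ∃ e' ∈ F, e ≠ e' ∧ ends e = ends e'
  · obtain ⟨e, he, e', he', hne, hpar⟩ := hpar
    rw [typedCount_merge F τ _ he he' hne (KI_mergeT ends o a₁ a₂ a₃ b hpar hne)]
    refine Finset.sum_nonneg fun t _ => mul_nonneg (Nat.cast_nonneg _) ?_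
    refine ih (F.erase e').card ?_ (F.erase e') (Function.update τ e t) ?_ rfl
    · rw [← hn]; exact Finset.card_erase_lt_of_mem he'
    · exact fun g hg => hall g (Finset.mem_of_mem_erase hg)
  have hloop : ∀ e ∈ F, ¬ (ends e).IsDiag := fun e he h => hl ⟨e, he, h⟩
  have hpar' : ∀ e ∈ F, ∀ e' ∈ F, ends e = ends e' → e = e' := fun e he e' he' h => by
    by_contra hne
    exact hpar ⟨e, he, e', he', hne, h⟩
  have hM : ∀ e ∈ F, ∀ v ∈ ends e, v ∈ marks o a₁ a₂ a₃ b := by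
    intro e he v hv
    simp only [marks, Set.mem_insert_iff, Set.mem_singleton_iff]
    exact hall e he v hv
  have hinj := markMap_injOn h12 h31 h32 ho1 ho2 hb1 hb2 ho3
  have ho : o ∈ marks o a₁ a₂ a₃ b := by simp [marks]
  have h1 : a₁ ∈ marks o a₁ a₂ a₃ b := by simp [marks]
  have h2 : a₂ ∈ marks o a₁ a₂ a₃ b := by simp [marks]
  have h3 : a₃ ∈ marks o a₁ a₂ a₃ b := by simp [marks]
  have hb : b ∈ marks o a₁ a₂ a₃ b := by simp [marks]
  rw [typedCount_congr_closedOff F τ _ (fun x y w =>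
      CaseOne.KI (R := R) ends5 (markMap o a₁ a₂ a₃ b o) (markMap o a₁ a₂ a₃ b a₁) (markMap o a₁ a₂ a₃ b a₂)
        (markMap o a₁ a₂ a₃ b a₃) (markMap o a₁ a₂ a₃ b b)
        (patternM (markMap o a₁ a₂ a₃ b) ends F x) (patternM (markMap o a₁ a₂ a₃ b) ends F y)
        (patternM (markMap o a₁ a₂ a₃ b) ends F w))
      (fun x y w hx hy hw => KI_patternM (markMap o a₁ a₂ a₃ b) ends F hinj hM hloop ho h1 h2 h3 hb hx hy hw),
    typedCount_patternM_eq (markMap o a₁ a₂ a₃ b) ends F hinj hM hloop hpar',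
    markMap_o, markMap_a₁ ho1, markMap_a₂ h12 ho2, markMap_a₃ h31 h32 ho3,
    distinct_marks hb1 hb2 hbo hb3]
  exact typedCount_KI_nonneg _ _ _

end Theorems

end K5

end Summit.Ventures.PercRepro2
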